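import Literature.AlgebraicGeometry.Resolution.PointBlowupFlagInvariant
import Literature.AlgebraicGeometry.Resolution.PointBlowupPackageBound
import Mathlib.Algebra.Polynomial.Taylor
import Mathlib.Algebra.Polynomial.HasseDeriv
import Mathlib.Algebra.Polynomial.Div
import HarnessLib

/-!
# Hauser–Perlega, Lemma 2 for arbitrary tangent flags: `d^curv_𝓕 ≤ ord H + p^{e−1}`, `d_𝓕 ≤ d_res + p^{e−1}`, `d^curv_𝓕 < pᵉ`

H. Hauser, S. Perlega, *Resolving surface singularities in positive characteristic*, Publ. RIMS Kyoto Univ. **60**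
(2024) 767–813 [cite: HauserPerlega2024], Lemma 2 (statement p. 789, proof pp. 789–790), and its uses: §4 p. 780
("For all `t ∈ K*`, the inequality `d_t ≤ d_res + p^{e−1}` holds, as will be seen in Lemma 2 below"), the proof of
Proposition 3, p. 791 ("By Lemmas 1 and 2, the inequality `d_𝓕 ≤ d_res + p^{e−1}` holds for all flags `𝓕 ∈ F`"), and
the proof of Proposition 4, case (iv), p. 795 ("By Lemma 2 we know that `d_𝓕 ≤ ord H + ε`, where `ε = p^{e−1}` if `pᵉ`
divides `ord_ω(F'₀)`, `0` otherwise").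

Printed statement (p. 789): "**Lemma 2.** Let `𝓕 ∈ F` be a flag of the form `F₂ = V(z₁)`, `F₁ = V(z₁, y₁)`, where
`y₁ = y + h(x)` and `z₁ = z + g(x, y)` is the change of parameters which eliminates all `pᵉ`th powers from the
expansion of `F` with respect to `x, y₁`. Assume that `n_𝓕 = ord h > 0` and set `n = n_𝓕`. Let `ω : K[[x, y]] → ℕ∞` be
the weighted order that is defined by `ω(x) = 1` and `ω(y) = n`. Further, consider a factorization of the weighted
initial form `in_ω(F)` of the form `in_ω(F) = x^a y^b · H(x, y)`. Then the following inequality holds: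
`d^curv_𝓕 ≤ ord H + p^{e−1}` if `pᵉ` divides `ord_ω(F)`, `d^curv_𝓕 ≤ ord H` otherwise. In particular, if `ord H = 0`,
then `d_𝓕 = 0`. Further, in the special case `ord H = pᵉ − p^{e−1}`, the inequality `d^curv_𝓕 < pᵉ` holds."

The flag datum `Φ = (curve y, other x, h)` of `PointBlowupFlagInvariant` is exactly this presentation (`y₁ = y + h(x)`,
`Φ.expansion q F` = the clean expansion of `F(x, y₁ − h(x))`, `dCurv` = `d^curv_𝓕`, `dFlag` = `d_𝓕`, `wOrder` = `ord_ω`).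

## What is proved (sorry-free; `K` any field unless said; two letters `x ≠ y` exhausting `σ`)

* `exists_coeff_taylor_clean` (Section A) — the univariate core of the printed proof: for a prime `p`, `q = pᵉ`, a
  polynomial `P ≠ 0` whose exponents `b` satisfy `¬(q ∣ b ∧ q ∣ w₀)` and lie in `[β, D]`, and `t ≠ 0`, the Taylor
  shift `P(Y + t)` has a non-zero coefficient `k` with `¬(q ∣ k ∧ q ∣ w₀)`, `k ≤ (D − β) + p^{e−1}`, and `k ≤ D − β`
  if `q ∤ w₀` (Hasse derivative `∂^{(p^k)}` of the maximal level `k < e`: it kills `p^{k+1}`-th powers — Lucas — and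
  commutes with the shift, `hasseDeriv_taylor`; then the trailing degree of a shift is at most `deg − tdeg`).
* `coeff_substFree_of_weight_le` (Sections B–C) — the expansion `F(x, y + φ(x))`, `ord φ ≥ n`, `φ_n = t`: no monomial
  of weight `< w₀ = min_{d ∈ supp F} (d_x + n d_y)`, and on the weight line `w₀` the coefficient of `x^{w₀−nb} y^b`
  is the coefficient of `Y^b` in `P♭(Y + t)`, `P♭ = flatInitial x y n F = Σ_{ω(d) = w₀} c_d Y^{d_y}` the flattened
  weighted initial form ("`F = in_ω(F)(x, y₁ − t xⁿ) + K(x, y₁)`, `ω₁(K) > ω₁(F)`", p. 789–790) — by a direct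
  coefficient computation (`coeff_X_pow_mul_add_pow`: binomial expansion of `x^a (y + ψ)^b`, `ψ = φ(x)`).
* `dCurv_le_of_coeff_taylor_ne_zero` (Section D) — "`ord_{ω₁}(F₁) = ord_ω(F)`": the weighted order of the CLEAN
  expansion is `w₀`, and `d^curv_𝓕 ≤ k` for every surviving exponent `k` as above (the monomial `x₁^{w₀−nk} y₁^k`
  is not a `q`-th power, so the cleaning keeps it, and it lies in `in_{ω₁}`).
* `dCurv_le_ordH` — the FIRST ASSERTION OF LEMMA 2 as printed, with `ord H` written as `deg P♭ − tdeg P♭` (for two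
  letters the monomials of `in_ω(F)` are `x^{w₀ − n d_y} y^{d_y}`, so `b = tdeg P♭`, `a = w₀ − n·deg P♭`, and
  `ord H = min_d (n(deg P♭ − d_y) + (d_y − b)) = deg P♭ − tdeg P♭` as `n ≥ 1`), and "`pᵉ` divides `ord_ω(F)`" as
  `pᵉ ∣ w₀`; `dFlag_eq_zero_of_natDegree_eq` — the SECOND ASSERTION "if `ord H = 0`, then `d_𝓕 = 0`";
  `dCurv_lt_of_ordH_eq` — the THIRD ASSERTION "in the special case `ord H = pᵉ − p^{e−1}`, `d^curv_𝓕 < pᵉ`", obtained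
  from the stronger `dCurv_lt_of_ordH_lt` (`ord H < pᵉ ⇒ d^curv_𝓕 < pᵉ`, Section E) whose univariate core
  `exists_coeff_taylor_lt` is a shorter count than the printed one: if no monomial `x₁^{w₀−nk} y₁^k`, `k < q`,
  `q ∤ k`, survived, then `P♭(Y + t) = a₀ + Y^q S`, `P♭ = a₀ + (Y^q − t^q)·S(Y − t)` in characteristic `p`, and the
  trailing exponent of `P♭` would be divisible by `q` (DEVIATION from the printed digit comparison of `∂_y F′`,
  recorded).
* `natDegree_flatInitial_le_of_ordZero` — `ord H ≤ deg P♭ − ordVar_y F ≤ (ord F − ordVar_x F) − ordVar_y F ≤ d_res(E)`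
  for every set `E` of exceptional letters (p. 780: `d_t ≤ d_res + p^{e−1}` via Lemma 2, i.e. `ord H ≤ d_res`).
* `tangentFlagBoundStatement_holds` — **the observatory's named statement `TangentFlagBoundStatement p e K` of
  `PointBlowupFlagInvariant` (recorded there as NOT asserted) HOLDS**: for `K` algebraically closed of characteristic
  `p`, every `E`, every `F ≠ 0` clean w.r.t. `pᵉ`, every flag datum of the tangent case (ii) with `ord h = n`:
  `d_𝓕 ≤ d_res(E) + p^{e−1}`.  (Characteristic `0`, `p = 0`, is covered by the branch `q ∤ w₀`; the hypothesis
  `pᵉ < ord F` of the statement is not needed.)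

## What is NOT proved here

* Lemma 1 (every flag has the triangular presentation — Weierstrass preparation; the tree's `FlagDatum` takes the
  presentation as data), Lemma 3, Propositions 3–4 of [HP24]; the factorisation `in_ω(F) = x^a y^b·H` is not
  introduced as a notion (only its order `deg P♭ − tdeg P♭`); the printed route to the third assertion (the
  `p^{e−1}`-th root `F′` and the two expressions for `∂_y F′`, p. 790) is not transcribed — a different, shorter
  argument is given.

## Architecture (follows the printed proof, pp. 789–790, in the polynomial model)

Printed: `y₁ = y + t xⁿ + h₁(x)`, `ord h₁ > n`; `F = in_ω(F)(x, y₁ − t xⁿ) + K`, `ω₁(K) > ω₁(F)`; cleanness of `F` ⇒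
`in_ω(F)(x, y₁ − t xⁿ)` is not a `pᵉ`-th power ⇒ `ord_{ω₁}(F₁) = ord_ω(F)` and `in_{ω₁}(F₁) = in_ω(F)(x, y₁ − txⁿ) + G^{pᵉ}`;
if `pᵉ ∤ ω(F)` then `G = 0`; else apply `∂_{y}^{(p^k)}`, `k < e` maximal such that `in_ω(F)` is a `p^k`-th power, and
use that `∂` lowers `ord_{(y₁)}` by at most `p^k` and commutes with the substitution.  Here the weighted-homogeneous
series `in_ω(F)(x, y₁ − t xⁿ) = x₁^{w₀}·P♭(y₁/x₁ⁿ − t)` is handled through the one-variable polynomial `P♭`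
(Section A is the `∂^{(p^k)}`-and-shift count on `P♭`, with the tree's sign convention `φ = −h`, `t = −h_n`);
Sections B–C compute the coefficients of the substitution below and on the weight line directly (no appeal to
"`ω₁(K) > ω₁(F)`" beyond the vanishing below `w₀`); Section D reads `ord_ω`, `in_ω`, `d^curv_𝓕`, `d_𝓕` (the definitions
of `PointBlowupFlagInvariant`) off the surviving monomial; Section E is the third assertion.  The generic two-letter
bookkeeping (`pkgWeight`, `minPkgWeight`, `pkgInitial`, `apply_add_le_of_mem_support_pkgInitial`) is imported from
`PointBlowupPackageBound`.
-/

noncomputable section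

open scoped BigOperators

namespace Literature.AlgebraicGeometry.Resolution

open Literature.AlgebraicGeometry.Resolution.Hauser2010
open Literature.AlgebraicGeometry.Resolution.PointBlowup
open Literature.AlgebraicGeometry.Resolution.HauserWagner2014

namespace HauserPerlega2024

/-! ## A. Univariate endgame: Hasse derivatives, Taylor shifts, trailing degrees -/

section Univariate

open Polynomial

variable {K : Type*} [Field K]

/-- Hasse derivatives commute with Taylor shifts. [folklore] -/
private theorem hasseDeriv_taylor (k : ℕ) (t : K) (f : K[X]) :
    Polynomial.hasseDeriv k (Polynomial.taylor t f) = Polynomial.taylor t (Polynomial.hasseDeriv k f) := by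
  ext i
  rw [Polynomial.hasseDeriv_coeff, Polynomial.taylor_coeff, Polynomial.taylor_coeff]
  have h := congrArg (fun L : K[X] →ₗ[K] K[X] => (L f).eval t) (Polynomial.hasseDeriv_comp (R := K) i k)
  simp only [LinearMap.comp_apply, LinearMap.smul_apply] at h
  rw [h, Polynomial.eval_smul, nsmul_eq_mul, Nat.choose_symm_add]

/-- The trailing degree of a Taylor shift `f(X + t)`, `t ≠ 0`, is at most `deg f − β` when `X^β ∣ f`:
the factor `(X + t)^β` is a unit at the origin. [folklore] -/
private theorem natTrailingDegree_taylor_le {t : K} (ht : t ≠ 0) {f : K[X]} (hf : f ≠ 0) {β D : ℕ}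
    (hβ : ∀ k, f.coeff k ≠ 0 → β ≤ k) (hD : f.natDegree ≤ D) :
    (Polynomial.taylor t f).natTrailingDegree ≤ D - β := by
  have hdvd : X ^ β ∣ f := by
    rw [Polynomial.X_pow_dvd_iff]
    intro d hd
    by_contra h
    exact absurd (hβ d h) (not_le.mpr hd)
  obtain ⟨g, hg⟩ := hdvd
  have hg0 : g ≠ 0 := by rintro rfl; exact hf (by rw [hg, mul_zero])
  have hXt : Polynomial.taylor t (X ^ β : K[X]) = (X + C t) ^ β := by rw [Polynomial.taylor_pow, Polynomial.taylor_X]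
  have hXt0 : ((X + C t) ^ β : K[X]) ≠ 0 := pow_ne_zero _ (Polynomial.X_add_C_ne_zero t)
  have htg0 : Polynomial.taylor t g ≠ 0 := fun h => hg0 ((Polynomial.taylor_eq_zero t g).mp h)
  have h1 : (Polynomial.taylor t f).natTrailingDegree =
      ((X + C t) ^ β : K[X]).natTrailingDegree + (Polynomial.taylor t g).natTrailingDegree := by
    rw [hg, Polynomial.taylor_mul, hXt, Polynomial.natTrailingDegree_mul hXt0 htg0]
  have h2 : ((X + C t) ^ β : K[X]).natTrailingDegree = 0 := by
    apply Nat.eq_zero_of_le_zero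
    apply Polynomial.natTrailingDegree_le_of_ne_zero
    rw [Polynomial.coeff_X_add_C_pow, Nat.sub_zero, Nat.choose_zero_right, Nat.cast_one, mul_one]
    exact pow_ne_zero _ ht
  have h3 : (Polynomial.taylor t g).natTrailingDegree ≤ g.natDegree :=
    le_trans (Polynomial.natTrailingDegree_le_natDegree _) (Polynomial.natDegree_taylor g t).le
  have h4 : f.natDegree = β + g.natDegree := by
    rw [hg, Polynomial.natDegree_mul (pow_ne_zero _ Polynomial.X_ne_zero) hg0, Polynomial.natDegree_X_pow]
  omega

/-- The Taylor shift `f(X + t)` of a non-zero polynomial with coefficients supported in `[β, D]` has a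
non-zero coefficient in degree `≤ D − β`. [folklore] -/
private theorem exists_coeff_taylor_ne_zero {t : K} (ht : t ≠ 0) {f : K[X]} (hf : f ≠ 0) {β D : ℕ}
    (hβ : ∀ k, f.coeff k ≠ 0 → β ≤ k) (hD : f.natDegree ≤ D) :
    ∃ k, (Polynomial.taylor t f).coeff k ≠ 0 ∧ k ≤ D - β := by
  refine ⟨(Polynomial.taylor t f).natTrailingDegree, ?_, natTrailingDegree_taylor_le ht hf hβ hD⟩
  exact Polynomial.coeff_natTrailingDegree_ne_zero.mpr fun h => hf ((Polynomial.taylor_eq_zero t f).mp h)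

variable (p : ℕ) [hp : Fact p.Prime] [CharP K p]

omit hp [CharP K p] in
/-- The level of a finite set of positive exponents: some `k < e` such that `p^k` divides all of them
and `p^{k+1}` does not divide one of them (given that `pᵉ` does not divide one of them). [folklore] -/
private theorem exists_level_coeff {e : ℕ} {f : K[X]} {b₁ : ℕ} (hb₁ : f.coeff b₁ ≠ 0)
    (hq : ¬ p ^ e ∣ b₁) :
    ∃ k, k < e ∧ (∀ b, f.coeff b ≠ 0 → p ^ k ∣ b) ∧ ∃ b₀, f.coeff b₀ ≠ 0 ∧ ¬ p ^ (k + 1) ∣ b₀ := by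
  classical
  have he : 1 ≤ e := by
    by_contra h0
    have : e = 0 := by omega
    subst this
    exact hq (by rw [pow_zero]; exact one_dvd _)
  have hQ : ∃ k, ∃ b₀, f.coeff b₀ ≠ 0 ∧ ¬ p ^ (k + 1) ∣ b₀ :=
    ⟨e - 1, b₁, hb₁, by rw [Nat.sub_add_cancel he]; exact hq⟩
  refine ⟨Nat.find hQ, ?_, ?_, Nat.find_spec hQ⟩
  · have h := Nat.find_min' hQ (m := e - 1) ⟨b₁, hb₁, by rw [Nat.sub_add_cancel he]; exact hq⟩
    omega
  · intro b hb
    rcases Nat.eq_zero_or_eq_succ_pred (Nat.find hQ) with h0 | hsucc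
    · rw [h0, pow_zero]; exact one_dvd _
    · have hmin := Nat.find_min hQ (m := (Nat.find hQ).pred) (by omega)
      push Not at hmin
      have := hmin b hb
      have e1 : (Nat.find hQ).pred + 1 = Nat.find hQ := by omega
      rwa [e1] at this

/-- **The univariate form of [HP24, Lemma 2].** `q = pᵉ`; `P ≠ 0` a polynomial whose exponents `b`
lie in `[β, D]` and satisfy the cleanness condition `¬(q ∣ b ∧ q ∣ w₀)`; `t ≠ 0`. Then the Taylor shift
`P(Y + t)` has a coefficient `k` which is non-zero, satisfies the same cleanness condition, and is
`≤ (D − β) + p^{e−1}`; if `q ∤ w₀` even `≤ D − β`. (The Hasse derivative `∂^{(p^k)}` of the maximal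
level kills the `q`-th powers and commutes with the shift.) [cite: HauserPerlega2024, Lemma 2 p. 789–790] -/
theorem exists_coeff_taylor_clean {e : ℕ} {P : K[X]} (hP : P ≠ 0) {t : K} (ht : t ≠ 0) {w₀ β D : ℕ}
    (hclean : ∀ b, P.coeff b ≠ 0 → ¬ (p ^ e ∣ b ∧ p ^ e ∣ w₀))
    (hβ : ∀ b, P.coeff b ≠ 0 → β ≤ b) (hD : P.natDegree ≤ D) :
    ∃ k, (Polynomial.taylor t P).coeff k ≠ 0 ∧ ¬ (p ^ e ∣ k ∧ p ^ e ∣ w₀) ∧ k ≤ D - β + p ^ (e - 1) ∧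
      (¬ p ^ e ∣ w₀ → k ≤ D - β) := by
  by_cases hw : p ^ e ∣ w₀
  · -- every exponent of `P` is prime to `q`; probe with the Hasse derivative of the maximal level
    obtain ⟨b₁, hb₁⟩ : ∃ b, P.coeff b ≠ 0 := by
      by_contra h
      push Not at h
      exact hP (Polynomial.ext fun n => by rw [h n, Polynomial.coeff_zero])
    have hq1 : ¬ p ^ e ∣ b₁ := fun h => hclean b₁ hb₁ ⟨h, hw⟩
    obtain ⟨k, hk, hall, b₀, hb₀, hb₀k⟩ := exists_level_coeff p hb₁ hq1
    set A : ℕ := p ^ k with hA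
    have hAb₀ : A ∣ b₀ := hall b₀ hb₀
    have hchoose : ((b₀.choose A : ℕ) : K) ≠ 0 := by
      rw [Ne, hA, natCast_choose_prime_pow_eq_zero_iff p K]
      intro hdiv
      apply hb₀k
      obtain ⟨c, hc⟩ := hdiv
      have h2 : b₀ = p ^ k * (b₀ / p ^ k) := (Nat.mul_div_cancel' hAb₀).symm
      rw [h2, hc, pow_succ]
      exact mul_dvd_mul_left _ (dvd_mul_right p c)
    have hAle : A ≤ b₀ := Nat.le_of_dvd (Nat.pos_of_ne_zero fun h => by
      rw [h] at hb₀k; exact hb₀k (dvd_zero _)) hAb₀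
    -- the Hasse derivative of `P` of order `A` is non-zero
    set P₂ : K[X] := Polynomial.hasseDeriv A P with hP₂
    have hP₂coeff : P₂.coeff (b₀ - A) ≠ 0 := by
      rw [hP₂, Polynomial.hasseDeriv_coeff, Nat.sub_add_cancel hAle]
      exact mul_ne_zero hchoose hb₀
    have hP₂0 : P₂ ≠ 0 := fun h => hP₂coeff (by rw [h, Polynomial.coeff_zero])
    have hβ₂ : ∀ m, P₂.coeff m ≠ 0 → β - A ≤ m := by
      intro m hm
      rw [hP₂, Polynomial.hasseDeriv_coeff] at hm
      have h1 : P.coeff (m + A) ≠ 0 := fun h => hm (by rw [h, mul_zero])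
      have h2 := hβ _ h1
      omega
    have hD₂ : P₂.natDegree ≤ D - A := le_trans (Polynomial.natDegree_hasseDeriv_le P A) (by omega)
    obtain ⟨l, hl, hlle⟩ := exists_coeff_taylor_ne_zero ht hP₂0 hβ₂ hD₂
    rw [hP₂, ← hasseDeriv_taylor, Polynomial.hasseDeriv_coeff] at hl
    have hc1 : (((l + A).choose A : ℕ) : K) ≠ 0 := fun h => hl (by rw [h, zero_mul])
    have hc2 : (Polynomial.taylor t P).coeff (l + A) ≠ 0 := fun h => hl (by rw [h, mul_zero])
    have hndvd : ¬ p ^ e ∣ l + A := fun h =>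
      hc1 (by rw [hA]; exact natCast_choose_prime_pow_eq_zero_of_pow_dvd p K hk (hA ▸ h))
    have hApow : A ≤ p ^ (e - 1) := by
      rw [hA]; exact Nat.pow_le_pow_right hp.out.pos (by omega)
    refine ⟨l + A, hc2, fun h => hndvd h.1, by omega, fun h => (h hw).elim⟩
  · obtain ⟨k, hk, hkle⟩ := exists_coeff_taylor_ne_zero ht hP hβ hD
    exact ⟨k, hk, fun h => hw h.2, by omega, fun _ => hkle⟩

/-! ### Powers of a power series of order `n` with leading coefficient `t` -/

/-- If `coeff m φ = 0` for `m < n` and `coeff n φ = t`, then `coeff m (φ^j) = 0` for `m < n·j` and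
`coeff (n·j) (φ^j) = t^j`. [folklore] -/
private theorem coeff_pow_of_order {φ : PowerSeries K} {n : ℕ} {t : K}
    (hlt : ∀ m, m < n → PowerSeries.coeff m φ = 0) (heq : PowerSeries.coeff n φ = t) (j : ℕ) :
    (∀ m, m < n * j → PowerSeries.coeff m (φ ^ j) = 0) ∧ PowerSeries.coeff (n * j) (φ ^ j) = t ^ j := by
  induction j with
  | zero =>
    refine ⟨fun m hm => ?_, ?_⟩
    · simp at hm
    · simp
  | succ j ih =>
    obtain ⟨ih1, ih2⟩ := ih
    have key : ∀ m, m ≤ n * (j + 1) → PowerSeries.coeff m (φ ^ (j + 1)) =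
        if m = n * (j + 1) then t ^ (j + 1) else 0 := by
      intro m hm
      rw [pow_succ, PowerSeries.coeff_mul]
      by_cases hmeq : m = n * (j + 1)
      · rw [if_pos hmeq, Finset.sum_eq_single (n * j, n)]
        · rw [ih2, heq, pow_succ]
        · rintro ⟨u, v⟩ huv hne
          rw [Finset.mem_antidiagonal] at huv
          simp only at huv
          by_cases hu : u < n * j
          · rw [ih1 u hu, zero_mul]
          · have hv : v < n := by
              push Not at hu
              by_contra hv'
              push Not at hv'
              apply hne
              have h1 : u = n * j := by rw [Nat.mul_succ] at hmeq; omega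
              have h2 : v = n := by rw [Nat.mul_succ] at hmeq; omega
              rw [h1, h2]
            rw [hlt v hv, mul_zero]
        · intro h
          exfalso; apply h
          rw [Finset.mem_antidiagonal, hmeq, Nat.mul_succ]
      · rw [if_neg hmeq]
        refine Finset.sum_eq_zero ?_
        rintro ⟨u, v⟩ huv
        rw [Finset.mem_antidiagonal] at huv
        simp only at huv
        by_cases hu : u < n * j
        · rw [ih1 u hu, zero_mul]
        · have hv : v < n := by
            push Not at hu
            rw [Nat.mul_succ] at hm hmeq
            omega
          rw [hlt v hv, mul_zero]
    refine ⟨fun m hm => ?_, ?_⟩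
    · rw [key m hm.le, if_neg (Nat.ne_of_lt hm)]
    · rw [key _ le_rfl, if_pos rfl]

end Univariate

/-! ## B. Two letters: the coefficients of the subordinate expansion `F(x₁, y₁ − h(x₁))`

The bridge from the flag invariant of [HP24, §5] to the univariate endgame: with `ω(x₁) = 1`, `ω(y₁) = n = ord h`, the
substitution `y ↦ y₁ + φ(x₁)` (`φ = −h`, leading term `t·x₁ⁿ`) does not lower the weight, nothing of weight `< w₀ = ord_ω F`
appears, and on the weight line `w₀` the expansion is the Taylor shift `P♭(Y + t)` of the flattened weighted initial form
`P♭(Y) = Σ_{ω(d) = w₀} c_d Y^{d_y}` ("in_ω(F)(x₁, y₁ + t x₁ⁿ)"). -/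

section TwoLetters

variable {σ : Type*} [DecidableEq σ] {K : Type*} [Field K]

/-- two letters: `univ = {x, y}`. [folklore] -/
private theorem univ_eq_pair [Fintype σ] {x y : σ} (hσ : ∀ l, l = x ∨ l = y) :
    (Finset.univ : Finset σ) = {x, y} := by
  ext l
  simp only [Finset.mem_univ, Finset.mem_insert, Finset.mem_singleton, true_iff]
  exact hσ l

/-- two letters: a sum over all letters has two terms. [folklore] -/
private theorem sum_univ_two [Fintype σ] {M : Type*} [AddCommMonoid M] {x y : σ} (hxy : x ≠ y)
    (hσ : ∀ l, l = x ∨ l = y) (f : σ → M) : ∑ l, f l = f x + f y := by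
  rw [univ_eq_pair hσ, Finset.sum_pair hxy]

/-- two letters: a product over all letters has two factors. [folklore] -/
private theorem prod_univ_two [Fintype σ] {M : Type*} [CommMonoid M] {x y : σ} (hxy : x ≠ y)
    (hσ : ∀ l, l = x ∨ l = y) (f : σ → M) : ∏ l, f l = f x * f y := by
  rw [univ_eq_pair hσ, Finset.prod_pair hxy]

omit [DecidableEq σ] in
/-- two letters: an exponent is determined by its two entries. [folklore] -/
private theorem finsupp_eq_two {x y : σ} (hσ : ∀ l, l = x ∨ l = y) {d d' : σ →₀ ℕ} (hx : d x = d' x)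
    (hy : d y = d' y) : d = d' := by
  ext l
  rcases hσ l with rfl | rfl
  · exact hx
  · exact hy

omit [DecidableEq σ] in
/-- two letters: comparison of exponents is comparison of the two entries. [folklore] -/
private theorem finsupp_le_iff_two {x y : σ} (hσ : ∀ l, l = x ∨ l = y) {f g : σ →₀ ℕ} :
    f ≤ g ↔ f x ≤ g x ∧ f y ≤ g y := by
  refine ⟨fun h => ⟨h x, h y⟩, fun h => ?_⟩
  intro l
  rcases hσ l with rfl | rfl
  · exact h.1
  · exact h.2

omit [DecidableEq σ] in
/-- the exponent `x^a y^b` evaluated at `x`. [folklore] -/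
private theorem single_add_single_apply_left {x y : σ} (hxy : x ≠ y) (a b : ℕ) :
    (Finsupp.single x a + Finsupp.single y b) x = a := by
  classical
  rw [Finsupp.add_apply, Finsupp.single_eq_same, Finsupp.single_apply, if_neg (Ne.symm hxy), add_zero]

omit [DecidableEq σ] in
/-- the exponent `x^a y^b` evaluated at `y`. [folklore] -/
private theorem single_add_single_apply_right {x y : σ} (hxy : x ≠ y) (a b : ℕ) :
    (Finsupp.single x a + Finsupp.single y b) y = b := by
  classical
  rw [Finsupp.add_apply, Finsupp.single_eq_same, Finsupp.single_apply, if_neg hxy, zero_add]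

/-- The weights of case (ii) on two letters: `ω(x₁^i y₁^j) = i + n·j` (`ω(x₁) = 1`, `ω(y₁) = n`).
[cite: HauserPerlega2024, §5 p. 784 (weighted order ω on K[[x₁, y₁]], ω(x₁) = 1, ω(y₁) = n_𝓕)] -/
theorem weight_weights_eq [Fintype σ] (Φ : FlagDatum σ K) (hne : Φ.curve ≠ Φ.other)
    (hσ : ∀ l, l = Φ.other ∨ l = Φ.curve) (n : ℕ) (d : σ →₀ ℕ) :
    Finsupp.weight (Φ.weights n) d = d Φ.other + n * d Φ.curve := by
  rw [Finsupp.weight_apply, Finsupp.sum_fintype _ _ (fun i => by simp), sum_univ_two hne.symm hσ]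
  have h1 : Φ.weights n Φ.other = 1 := if_neg hne.symm
  have h2 : Φ.weights n Φ.curve = n := if_pos rfl
  rw [h1, h2, smul_eq_mul, smul_eq_mul, mul_one, mul_comm]

/-- The coefficients of `ψ^j`, `ψ = φ(x)`: supported on the `x`-axis, where they are those of `φ^j`. [folklore] -/
private theorem coeff_substX_pow (x : σ) (φ : PowerSeries K) (j : ℕ) (d : σ →₀ ℕ) :
    MvPowerSeries.coeff d ((PowerSeries.subst (MvPowerSeries.X x : MvPowerSeries σ K) φ) ^ j) =
      if d = Finsupp.single x (d x) then PowerSeries.coeff (d x) (φ ^ j) else 0 := by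
  rw [← PowerSeries.subst_pow (PowerSeries.HasSubst.X x), PowerSeries.coeff_subst_single]

/-- The coefficient of `x^{d_x} y^{d_y}` in `x^a (y + ψ)^b`, `ψ = φ(x)` with `ord φ = n` and leading coefficient `t`,
for `d` of weight `d_x + n·d_y ≤ a + n·b`: on the weight line through `(a, b)` and below `b` it is
`binom(b, d_y)·t^{b − d_y}`, otherwise `0`. [folklore] -/
private theorem coeff_X_pow_mul_add_pow {x y : σ} (hxy : x ≠ y) (hσ : ∀ l, l = x ∨ l = y)
    {φ : PowerSeries K} {n : ℕ} {t : K} (hlt : ∀ m, m < n → PowerSeries.coeff m φ = 0)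
    (heq : PowerSeries.coeff n φ = t) (a b : ℕ) (d : σ →₀ ℕ) (hd : d x + n * d y ≤ a + n * b) :
    MvPowerSeries.coeff d ((MvPowerSeries.X x : MvPowerSeries σ K) ^ a *
        (MvPowerSeries.X y + PowerSeries.subst (MvPowerSeries.X x : MvPowerSeries σ K) φ) ^ b) =
      if d y ≤ b ∧ d x + n * d y = a + n * b then ((b.choose (d y) : ℕ) : K) * t ^ (b - d y) else 0 := by
  set ψ : MvPowerSeries σ K := PowerSeries.subst (MvPowerSeries.X x : MvPowerSeries σ K) φ with hψ
  rw [(Commute.all (MvPowerSeries.X y : MvPowerSeries σ K) ψ).add_pow, Finset.mul_sum, map_sum]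
  have hterm : ∀ k ∈ Finset.range (b + 1),
      MvPowerSeries.coeff d ((MvPowerSeries.X x : MvPowerSeries σ K) ^ a *
          ((MvPowerSeries.X y) ^ k * ψ ^ (b - k) * (b.choose k : MvPowerSeries σ K))) =
        if k = d y then
          (if d y ≤ b ∧ d x + n * d y = a + n * b then ((b.choose (d y) : ℕ) : K) * t ^ (b - d y) else 0)
        else 0 := by
    intro k hk
    have hkb : k ≤ b := by rw [Finset.mem_range] at hk; omega
    have hrw : (MvPowerSeries.X x : MvPowerSeries σ K) ^ a * ((MvPowerSeries.X y) ^ k * ψ ^ (b - k) *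
        (b.choose k : MvPowerSeries σ K)) =
        MvPowerSeries.monomial (Finsupp.single x a + Finsupp.single y k) (1 : K) *
          (ψ ^ (b - k) * MvPowerSeries.C ((b.choose k : ℕ) : K)) := by
      rw [MvPowerSeries.X_pow_eq, MvPowerSeries.X_pow_eq, ← map_natCast (MvPowerSeries.C : K →+* MvPowerSeries σ K),
        ← mul_assoc, ← mul_assoc, MvPowerSeries.monomial_mul_monomial, one_mul, mul_assoc]
    rw [hrw, MvPowerSeries.coeff_monomial_mul]
    have hmx := single_add_single_apply_left hxy a k
    have hmy := single_add_single_apply_right hxy a k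
    by_cases hle : Finsupp.single x a + Finsupp.single y k ≤ d
    · have hle2 := (finsupp_le_iff_two hσ).mp hle
      rw [hmx, hmy] at hle2
      obtain ⟨hax, hky⟩ := hle2
      rw [if_pos hle, one_mul, MvPowerSeries.coeff_mul_C, hψ, coeff_substX_pow]
      have hsubx : (d - (Finsupp.single x a + Finsupp.single y k)) x = d x - a := by
        rw [Finsupp.tsub_apply, hmx]
      have hsuby : (d - (Finsupp.single x a + Finsupp.single y k)) y = d y - k := by
        rw [Finsupp.tsub_apply, hmy]
      by_cases hkeq : k = d y
      · -- on the `x`-axis: the coefficient of `φ^{b-k}` in degree `d_x − a`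
        have hcond : d - (Finsupp.single x a + Finsupp.single y k) =
            Finsupp.single x ((d - (Finsupp.single x a + Finsupp.single y k)) x) := by
          apply finsupp_eq_two hσ
          · rw [Finsupp.single_eq_same]
          · rw [hsuby, Finsupp.single_apply, if_neg hxy, hkeq, Nat.sub_self]
        rw [if_pos hcond, hsubx, if_pos hkeq]
        obtain ⟨hpow1, hpow2⟩ := coeff_pow_of_order hlt heq (b - k)
        by_cases hwt : d x + n * d y = a + n * b
        · have hdeg : d x - a = n * (b - k) := by
            subst hkeq
            zify [hax, hkb] at hwt ⊢
            linarith
          rw [hdeg, hpow2, if_pos ⟨hkeq ▸ hkb, hwt⟩, hkeq, mul_comm]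
        · have hdeg : d x - a < n * (b - k) := by
            subst hkeq
            have h1 : d x - a ≤ n * (b - d y) := by
              zify [hax, hkb] at hd ⊢
              linarith
            rcases h1.lt_or_eq with h | h
            · exact h
            · exfalso; apply hwt
              zify [hax, hkb] at h ⊢
              linarith
          rw [hpow1 _ hdeg, if_neg (fun h => hwt h.2), zero_mul]
      · -- off the `x`-axis
        have hcond : d - (Finsupp.single x a + Finsupp.single y k) ≠
            Finsupp.single x ((d - (Finsupp.single x a + Finsupp.single y k)) x) := by
          intro h
          have := DFunLike.congr_fun h y
          rw [hsuby, Finsupp.single_apply, if_neg hxy] at this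
          omega
        rw [if_neg hcond, if_neg hkeq, zero_mul]
    · rw [if_neg hle]
      by_cases hkeq : k = d y
      · rw [if_pos hkeq, if_neg]
        rintro ⟨-, hwt⟩
        have hax : ¬ a ≤ d x := fun hax =>
          hle ((finsupp_le_iff_two hσ).mpr ⟨by rw [hmx]; exact hax, by rw [hmy]; exact hkeq.le⟩)
        have h1 : n * b < n * d y := by omega
        have h2 := Nat.lt_of_mul_lt_mul_left h1
        omega
      · rw [if_neg hkeq]
  rw [Finset.sum_congr rfl hterm, Finset.sum_ite_eq' (Finset.range (b + 1)) (d y)]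
  by_cases hyb : d y ≤ b
  · rw [if_pos (Finset.mem_range.mpr (Nat.lt_succ_of_le hyb))]
  · rw [if_neg (fun h => hyb (Nat.le_of_lt_succ (Finset.mem_range.mp h))), if_neg (fun h => hyb h.1)]

end TwoLetters

/-! ## C. The expansion below and on the line of least weight -/

section WeightLine

variable {σ : Type*} [Fintype σ] [DecidableEq σ] {K : Type*} [Field K]

/-- The subordinate expansion as a sum over the monomials of `F`: `F(x, y + ψ) = Σ_d c_d x^{d_x} (y + ψ)^{d_y}`,
`ψ = φ(x)`. [cite: HauserWagner2014, §4 Remark 4 (triangular subordinate change y ↦ y + φ(x))] -/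
theorem coeff_substFree_eq_sum {x y : σ} (hxy : x ≠ y) (hσ : ∀ l, l = x ∨ l = y) (φ : PowerSeries K)
    (F : MvPolynomial σ K) (d : σ →₀ ℕ) :
    MvPowerSeries.coeff d (substFree x y φ F) =
      ∑ d' ∈ F.support, MvPolynomial.coeff d' F *
        MvPowerSeries.coeff d ((MvPowerSeries.X x : MvPowerSeries σ K) ^ (d' x) *
          (MvPowerSeries.X y + PowerSeries.subst (MvPowerSeries.X x : MvPowerSeries σ K) φ) ^ (d' y)) := by
  unfold substFree
  rw [MvPowerSeries.subst_coe]
  set a : σ → MvPowerSeries σ K := fun i => if i = y then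
      (MvPowerSeries.X y : MvPowerSeries σ K) + PowerSeries.subst (MvPowerSeries.X x : MvPowerSeries σ K) φ
    else MvPowerSeries.X i with ha
  have hax : a x = MvPowerSeries.X x := if_neg hxy
  have hay : a y = MvPowerSeries.X y + PowerSeries.subst (MvPowerSeries.X x : MvPowerSeries σ K) φ := if_pos rfl
  conv_lhs => rw [F.as_sum, map_sum, map_sum]
  refine Finset.sum_congr rfl fun d' _ => ?_
  rw [MvPolynomial.aeval_monomial, Finsupp.prod_fintype _ _ (fun i => pow_zero _), prod_univ_two hxy hσ,
    ← MvPowerSeries.c_eq_algebraMap, MvPowerSeries.coeff_C_mul, hax, hay]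

/-- The **flattened weighted initial form** `P♭(Y) = Σ_{ω(d) = w₀} c_d Y^{d_y}` of `F` for the weights `ω(x) = 1`,
`ω(y) = n`: the weighted initial form "`in_ω(g) = Σ_{ω(x^i y^j) = ω(g)} c_{ij} x^i y^j`" `= x^{w₀}·P♭(y/xⁿ)` read as a
polynomial in one variable (with two letters the weight line meets each row `d_y = b` once).
[cite: HauserPerlega2024, §4 p. 781 (in_ω(g)), §5 p. 784 (in_ω(F))] -/
def flatInitial (x y : σ) (n : ℕ) (F : MvPolynomial σ K) : Polynomial K :=
  ∑ d ∈ (pkgInitial x n F).support, Polynomial.monomial (d y) (MvPolynomial.coeff d F)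

omit [Fintype σ] [DecidableEq σ] in
/-- The coefficients of the Taylor shift `P♭(Y + t)`: `Σ_{ω(d) = w₀} c_d binom(d_y, k) t^{d_y − k}`. [folklore] -/
private theorem coeff_taylor_flatInitial (x y : σ) (n : ℕ) (F : MvPolynomial σ K) (t : K) (k : ℕ) :
    (Polynomial.taylor t (flatInitial x y n F)).coeff k =
      ∑ d ∈ (pkgInitial x n F).support, MvPolynomial.coeff d F * (t ^ (d y - k) * ((d y).choose k : K)) := by
  unfold flatInitial
  rw [map_sum, Polynomial.finsetSum_coeff]
  refine Finset.sum_congr rfl fun d _ => ?_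
  rw [Polynomial.taylor_monomial, Polynomial.coeff_C_mul, Polynomial.coeff_X_add_C_pow]

omit [Fintype σ] [DecidableEq σ] in
/-- a non-zero coefficient `Y^b` of `P♭` comes from a least-weight monomial `d` of `F` with `d_y = b`. [folklore] -/
private theorem exists_of_coeff_flatInitial_ne_zero {x y : σ} {n : ℕ} {F : MvPolynomial σ K} {b : ℕ}
    (hb : (flatInitial x y n F).coeff b ≠ 0) : ∃ d ∈ (pkgInitial x n F).support, d y = b := by
  by_contra h
  push Not at h
  apply hb
  unfold flatInitial
  rw [Polynomial.finsetSum_coeff]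
  refine Finset.sum_eq_zero fun d hd => ?_
  rw [Polynomial.coeff_monomial, if_neg (h d hd)]

/-- the exponents of `P♭` lie on the weight line: `n·b ≤ w₀`. [folklore] -/
private theorem mul_le_of_coeff_flatInitial_ne_zero {x y : σ} (hxy : x ≠ y) (hσ : ∀ l, l = x ∨ l = y) {n : ℕ}
    {F : MvPolynomial σ K} {b : ℕ} (hb : (flatInitial x y n F).coeff b ≠ 0) : n * b ≤ minPkgWeight x n F := by
  obtain ⟨d, hd, rfl⟩ := exists_of_coeff_flatInitial_ne_zero hb
  obtain ⟨-, hw⟩ := mem_support_pkgInitial.mp hd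
  rw [pkgWeight_eq_two hxy.symm hσ] at hw
  omega

omit [Fintype σ] [DecidableEq σ] in
/-- the degree of `P♭` is at most any bound for the `y`-exponents of the least-weight monomials. [folklore] -/
private theorem natDegree_flatInitial_le {x y : σ} {n : ℕ} {F : MvPolynomial σ K} {D : ℕ}
    (hD : ∀ d ∈ (pkgInitial x n F).support, d y ≤ D) : (flatInitial x y n F).natDegree ≤ D := by
  unfold flatInitial
  exact Polynomial.natDegree_sum_le_of_forall_le _ _ fun d hd => (Polynomial.natDegree_monomial_le _).trans (hD d hd)

/-- With two letters `P♭ ≠ 0` for `F ≠ 0` (the weight line meets each row once). [folklore] -/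
private theorem flatInitial_ne_zero {x y : σ} (hxy : x ≠ y) (hσ : ∀ l, l = x ∨ l = y) (n : ℕ)
    {F : MvPolynomial σ K} (hF : F ≠ 0) : flatInitial x y n F ≠ 0 := by
  obtain ⟨d₀, hd₀⟩ := MvPolynomial.ne_zero_iff.mp (pkgInitial_ne_zero x n hF)
  have hd₀s : d₀ ∈ (pkgInitial x n F).support := MvPolynomial.mem_support_iff.mpr hd₀
  have hcF : MvPolynomial.coeff d₀ F ≠ 0 := MvPolynomial.mem_support_iff.mp (mem_support_pkgInitial.mp hd₀s).1
  intro h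
  have hc : (flatInitial x y n F).coeff (d₀ y) = MvPolynomial.coeff d₀ F := by
    unfold flatInitial
    rw [Polynomial.finsetSum_coeff, Finset.sum_eq_single_of_mem d₀ hd₀s]
    · rw [Polynomial.coeff_monomial, if_pos rfl]
    · intro d hd hne
      rw [Polynomial.coeff_monomial, if_neg]
      intro hy'
      apply hne
      obtain ⟨-, hw⟩ := mem_support_pkgInitial.mp hd
      obtain ⟨-, hw₀⟩ := mem_support_pkgInitial.mp hd₀s
      rw [pkgWeight_eq_two hxy.symm hσ] at hw hw₀
      refine finsupp_eq_two hσ ?_ hy'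
      rw [hy'] at hw
      omega
  rw [h, Polynomial.coeff_zero] at hc
  exact hcF hc.symm

/-- **Nothing below the weighted order; the Taylor shift on the weight line.** Two letters, `ord φ ≥ n` with
`coeff_n φ = t`: the coefficient of `x^{d_x} y^{d_y}` in `F(x, y + φ(x))` vanishes for `d_x + n·d_y < w₀` and equals
the coefficient of `Y^{d_y}` in `P♭(Y + t)` for `d_x + n·d_y = w₀` — "`in_ω(F)`" of the expansion in the subordinate
parameters is `x₁^{w₀}·P♭(y₁/x₁ⁿ + t)`. [cite: HauserPerlega2024, §5 p. 784 (ord_ω F and in_ω(F) in the parameters (x₁, y₁))] -/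
theorem coeff_substFree_of_weight_le {x y : σ} (hxy : x ≠ y) (hσ : ∀ l, l = x ∨ l = y)
    {φ : PowerSeries K} {n : ℕ} {t : K} (hlt : ∀ m, m < n → PowerSeries.coeff m φ = 0)
    (heq : PowerSeries.coeff n φ = t) (F : MvPolynomial σ K) (d : σ →₀ ℕ)
    (hd : d x + n * d y ≤ minPkgWeight x n F) :
    MvPowerSeries.coeff d (substFree x y φ F) =
      if d x + n * d y = minPkgWeight x n F then (Polynomial.taylor t (flatInitial x y n F)).coeff (d y) else 0 := by
  rw [coeff_substFree_eq_sum hxy hσ]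
  have hw : ∀ d' ∈ F.support, minPkgWeight x n F ≤ d' x + n * d' y := fun d' hd' => by
    have := minPkgWeight_le x n hd'
    rwa [pkgWeight_eq_two hxy.symm hσ] at this
  split_ifs with hdeq
  · rw [coeff_taylor_flatInitial, support_pkgInitial, Finset.sum_filter]
    refine Finset.sum_congr rfl fun d' hd' => ?_
    rw [coeff_X_pow_mul_add_pow hxy hσ hlt heq _ _ d (hdeq.trans_le (hw d' hd')), pkgWeight_eq_two hxy.symm hσ]
    by_cases hw' : d' x + n * d' y = minPkgWeight x n F
    · rw [if_pos hw']
      by_cases hy : d y ≤ d' y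
      · rw [if_pos ⟨hy, by rw [hdeq, hw']⟩, mul_comm (((d' y).choose (d y) : ℕ) : K)]
      · rw [if_neg (fun h => hy h.1), Nat.choose_eq_zero_of_lt (not_le.mp hy)]
        simp
    · rw [if_neg hw', if_neg (fun h => hw' (by rw [← h.2, hdeq])), mul_zero]
  · refine Finset.sum_eq_zero fun d' hd' => ?_
    rw [coeff_X_pow_mul_add_pow hxy hσ hlt heq _ _ d (hd.trans (hw d' hd')),
      if_neg (fun h => hdeq (le_antisymm hd (by rw [h.2]; exact hw d' hd'))), mul_zero]

end WeightLine

/-! ## D. The flag invariant of case (ii): `ord_ω`, `in_ω`, `d^curv_𝓕`, `d_𝓕` and the bound -/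

section Unfold

variable {σ : Type*} {K : Type*} [Field K]

open scoped Classical in
/-- unfolding the cleaning (classical decidability, as in the definition). [folklore] -/
private theorem cleanSeries_apply (q : ℕ) (H : MvPowerSeries σ K) (d : σ →₀ ℕ) :
    cleanSeries q H d = if ∀ i, q ∣ d i then 0 else H d := rfl

/-- unfolding the weighted initial form. [folklore] -/
private theorem initialPart_apply (ω : σ → ℕ) (H : MvPowerSeries σ K) (d : σ →₀ ℕ) :
    initialPart ω H d = if ((Finsupp.weight ω d : ℕ) : ℕ∞) = wOrder ω H then H d else 0 := rfl

end Unfold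

section Flag

variable {σ : Type*} [Fintype σ] [DecidableEq σ] {K : Type*} [Field K]

omit [Fintype σ] [DecidableEq σ] in
/-- `ordVar_i F ≤ d_i` for every monomial `d` of `F`. [folklore] -/
private theorem ordVar_le_apply {F : MvPolynomial σ K} {d : σ →₀ ℕ} (hd : d ∈ F.support) (i : σ) :
    ordVar F i ≤ d i := by
  unfold ordVar bigH
  exact ENat.toNat_le_of_le_coe (Finset.inf_le hd)

/-- **The flag quantities of case (ii) read off the weight line.** Two letters `x = ψ`, `y = φ`; the flag datum
`(y, x, h)` with `ord h = n`; `t = −h_n`; `P♭` the flattened weighted initial form of `F` (`ω(x) = 1`, `ω(y) = n`,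
`w₀ = ord_ω F`). If `P♭(Y + t)` has a non-zero coefficient in a degree `k` with `¬(q ∣ k ∧ q ∣ w₀)` — so that the
monomial `x₁^{w₀ − nk} y₁^k` of the expansion survives the cleaning — then `ord_ω` of the clean expansion is `w₀`, its
weighted initial form contains `x₁^{w₀ − nk} y₁^k`, and `d_𝓕 ≤ d^curv_𝓕 ≤ k`.
[cite: HauserPerlega2024, §5 p. 784 (d^curv_𝓕 = ord_{F₁} in_ω(F); d_𝓕)] -/
theorem dCurv_le_of_coeff_taylor_ne_zero (x y : σ) (hxy : x ≠ y) (hσ : ∀ l, l = x ∨ l = y) (h : PowerSeries K)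
    {n : ℕ} (hord : h.order = n) (q : ℕ) {F : MvPolynomial σ K} {k : ℕ}
    (hk : (Polynomial.taylor (-(PowerSeries.coeff n h)) (flatInitial x y n F)).coeff k ≠ 0)
    (hkq : ¬ (q ∣ k ∧ q ∣ minPkgWeight x n F)) :
    wOrder (FlagDatum.weights ⟨y, x, h⟩ n) (FlagDatum.expansion ⟨y, x, h⟩ q F) = minPkgWeight x n F ∧
      dCurv q ⟨y, x, h⟩ n F ≤ (k : ℕ∞) := by
  have hordn := PowerSeries.order_eq_nat.mp hord
  have hlt : ∀ m, m < n → PowerSeries.coeff m (-h) = 0 := fun m hm => by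
    rw [map_neg, hordn.2 m hm, neg_zero]
  have heq : PowerSeries.coeff n (-h) = -(PowerSeries.coeff n h) := by rw [map_neg]
  have hwt : ∀ d : σ →₀ ℕ, Finsupp.weight (FlagDatum.weights ⟨y, x, h⟩ n) d = d x + n * d y :=
    fun d => weight_weights_eq (⟨y, x, h⟩ : FlagDatum σ K) hxy.symm hσ n d
  -- `n·k ≤ w₀`
  have hnk : n * k ≤ minPkgWeight x n F := by
    have hP0 : flatInitial x y n F ≠ 0 := fun h0 => hk (by rw [h0, map_zero, Polynomial.coeff_zero])
    have h1 : k ≤ (flatInitial x y n F).natDegree := by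
      have := Polynomial.le_natDegree_of_ne_zero hk
      rwa [Polynomial.natDegree_taylor] at this
    have h2 : (flatInitial x y n F).coeff (flatInitial x y n F).natDegree ≠ 0 := by
      rw [Polynomial.coeff_natDegree]
      exact Polynomial.leadingCoeff_ne_zero.mpr hP0
    exact le_trans (Nat.mul_le_mul_left n h1) (mul_le_of_coeff_flatInitial_ne_zero hxy hσ h2)
  -- the surviving monomial `x^{w₀ − nk} y^k`
  set dk : σ →₀ ℕ := Finsupp.single x (minPkgWeight x n F - n * k) + Finsupp.single y k with hdk
  have hdkx : dk x = minPkgWeight x n F - n * k := single_add_single_apply_left hxy _ _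
  have hdky : dk y = k := single_add_single_apply_right hxy _ _
  have hdkw : dk x + n * dk y = minPkgWeight x n F := by rw [hdkx, hdky]; omega
  have hexp : FlagDatum.expansion ⟨y, x, h⟩ q F = cleanSeries q (substFree x y (-h) F) := rfl
  have hGdk : MvPowerSeries.coeff dk (substFree x y (-h) F) ≠ 0 := by
    rw [coeff_substFree_of_weight_le hxy hσ hlt heq F dk hdkw.le, if_pos hdkw, hdky]
    exact hk
  have hnot : ¬ ∀ i, q ∣ dk i := by
    intro hall
    apply hkq
    have h1 : q ∣ k := by have := hall y; rwa [hdky] at this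
    have h2 : q ∣ minPkgWeight x n F - n * k := by have := hall x; rwa [hdkx] at this
    refine ⟨h1, ?_⟩
    have h3 : minPkgWeight x n F = (minPkgWeight x n F - n * k) + n * k := by omega
    rw [h3]
    exact dvd_add h2 (dvd_mul_of_dvd_right h1 n)
  have hEdk : MvPowerSeries.coeff dk (FlagDatum.expansion ⟨y, x, h⟩ q F) ≠ 0 := by
    rw [hexp, MvPowerSeries.coeff_apply, cleanSeries_apply, if_neg hnot]
    rwa [MvPowerSeries.coeff_apply] at hGdk
  have hElow : ∀ d : σ →₀ ℕ, d x + n * d y < minPkgWeight x n F →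
      MvPowerSeries.coeff d (FlagDatum.expansion ⟨y, x, h⟩ q F) = 0 := by
    intro d hd
    rw [hexp, MvPowerSeries.coeff_apply, cleanSeries_apply]
    split_ifs
    · rfl
    · have := coeff_substFree_of_weight_le hxy hσ hlt heq F d hd.le
      rw [if_neg (Nat.ne_of_lt hd), MvPowerSeries.coeff_apply] at this
      exact this
  -- the weighted order of the clean expansion
  have hwo : wOrder (FlagDatum.weights ⟨y, x, h⟩ n) (FlagDatum.expansion ⟨y, x, h⟩ q F) = minPkgWeight x n F := by
    unfold wOrder
    rw [MvPowerSeries.weightedOrder_eq_nat]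
    refine ⟨⟨dk, hEdk, by rw [hwt, hdkw]⟩, fun d hd => hElow d ?_⟩
    rwa [hwt] at hd
  refine ⟨hwo, ?_⟩
  -- the weighted initial form contains `dk`, so `d^curv ≤ k`
  have hin : initialPart (FlagDatum.weights ⟨y, x, h⟩ n) (FlagDatum.expansion ⟨y, x, h⟩ q F) dk ≠ 0 := by
    rw [initialPart_apply, hwo, hwt, if_pos (by rw [hdkw])]
    rwa [MvPowerSeries.coeff_apply] at hEdk
  unfold dCurv ordAlong
  refine le_trans (iInf₂_le dk hin) (le_of_eq ?_)
  show ((dk y : ℕ) : ℕ∞) = k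
  rw [hdky]

omit [Fintype σ] in
/-- `d_𝓕 ≤ d^curv_𝓕` (the first is the second or `0`). [cite: HauserPerlega2024, §5 p. 784 (d_𝓕)] -/
theorem dFlag_le_toNat_dCurv (q : ℕ) (Φ : FlagDatum σ K) (n : ℕ) (F : MvPolynomial σ K) :
    dFlag q Φ n F ≤ (dCurv q Φ n F).toNat := by
  unfold dFlag
  dsimp only
  split_ifs
  · exact Nat.zero_le _
  · exact le_rfl

/-- **`D − β ≤ d_res`.** Two letters, `n ≥ 1`, `ord F = o`: every least-weight monomial `d` of `F` has
`d_y + ordVar_x F ≤ o`, so with `D = o − ordVar_x F` (a bound for the `y`-exponents of `in_ω(F)`) and `β = ordVar_y F`: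
`D − β ≤ o − ordVar_x F − ordVar_y F ≤ d_res(E) = o − Σ_{i ∈ E} ordVar_i F` for every set `E` of exceptional letters.
[cite: HauserPerlega2024, §4 p. 776 (d_res = ord G = ord F − ord_{E_a} F), §5 p. 783 (d_𝓕 = d_res in case (i)), §4 p. 780 (d_t ≤ d_res + p^{e−1}: ord H ≤ d_res implicit)] -/
theorem natDegree_flatInitial_le_of_ordZero {x y : σ} (hxy : x ≠ y) (hσ : ∀ l, l = x ∨ l = y) {n : ℕ}
    (hn : 1 ≤ n) {F : MvPolynomial σ K} {o : ℕ} (ho : ordZero F = o) :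
    (flatInitial x y n F).natDegree ≤ o - ordVar F x ∧
      (∀ b, (flatInitial x y n F).coeff b ≠ 0 → ordVar F y ≤ b) ∧
      ∀ E : Finset σ, o - ordVar F x - ordVar F y ≤ dRes E F := by
  refine ⟨natDegree_flatInitial_le fun d hd => ?_, fun b hb => ?_, fun E => ?_⟩
  · have hr : ∀ d' ∈ (⟨F, Finsupp.single x (ordVar F x)⟩ : State σ K).F.support,
        (⟨F, Finsupp.single x (ordVar F x)⟩ : State σ K).r ≤ d' :=
      fun d' hd' => Finsupp.single_le_iff.mpr (ordVar_le_apply hd' x)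
    have := apply_add_le_of_mem_support_pkgInitial hxy.symm hσ hn ⟨F, Finsupp.single x (ordVar F x)⟩ ho hr hd
    dsimp only at this
    rw [Finsupp.single_eq_same] at this
    omega
  · obtain ⟨d, hd, rfl⟩ := exists_of_coeff_flatInitial_ne_zero hb
    exact ordVar_le_apply (mem_support_pkgInitial.mp hd).1 y
  · unfold dRes
    rw [ho, ENat.toNat_coe]
    have : ∑ i ∈ E, ordVar F i ≤ ordVar F x + ordVar F y :=
      calc ∑ i ∈ E, ordVar F i ≤ ∑ i, ordVar F i := Finset.sum_le_sum_of_subset (Finset.subset_univ E)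
        _ = ordVar F x + ordVar F y := sum_univ_two hxy hσ _
    omega

/-- The exponents of `P♭` inherit the cleanness of `F`: for a coefficient `Y^b ≠ 0`, `¬(q ∣ b ∧ q ∣ w₀)` (else the
monomial `x^{w₀ − nb} y^b` of `F` would be a `q`-th power).
[cite: HauserPerlega2024, Lemma 2 (proof) p. 790 ("Since F is clean, we know that in_ω(F)(x, y₁ − txⁿ) is not a pᵉth power")] -/
theorem not_dvd_of_coeff_flatInitial_ne_zero {x y : σ} (hxy : x ≠ y) (hσ : ∀ l, l = x ∨ l = y) (q : ℕ) {n : ℕ}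
    {F : MvPolynomial σ K} (hclean : deletePthPowers q F = F) {b : ℕ} (hb : (flatInitial x y n F).coeff b ≠ 0) :
    ¬ (q ∣ b ∧ q ∣ minPkgWeight x n F) := by
  rintro ⟨hqb, hqw⟩
  obtain ⟨d, hd, rfl⟩ := exists_of_coeff_flatInitial_ne_zero hb
  obtain ⟨hdF, hw⟩ := mem_support_pkgInitial.mp hd
  rw [pkgWeight_eq_two hxy.symm hσ] at hw
  apply not_isPthPowerExponent_of_clean q hclean hdF
  rw [isPthPowerExponent_iff]
  have hdx : q ∣ d x := by
    have h1 : d x = minPkgWeight x n F - n * d y := by omega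
    rw [h1]
    exact Nat.dvd_sub hqw (dvd_mul_of_dvd_right hqb n)
  intro i
  rcases hσ i with rfl | rfl
  · exact hdx
  · exact hqb

/-- **[HP24, Lemma 2], first assertion, as printed** (two letters, `q = pᵉ`, `F ≠ 0` clean, flag datum `(y, x, h)` with
`ord h = n ≥ 1`): "`d^curv_𝓕 ≤ ord H + p^{e−1}` if `pᵉ` divides `ord_ω(F)`, `d^curv_𝓕 ≤ ord H` otherwise", where
`in_ω(F) = x^a y^b·H`. With two letters the monomials of `in_ω(F)` are `x^{w₀ − n d_y} y^{d_y}`, so `b = tdeg P♭`,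
`a = w₀ − n·deg P♭` and `ord H = deg P♭ − tdeg P♭` (attained at the monomial of largest `d_y`, as `n ≥ 1`); and
`ord_ω(F)` (the weighted order of the CLEAN expansion in the subordinate parameters) is `w₀`
(`dCurv_le_of_coeff_taylor_ne_zero`). [cite: HauserPerlega2024, Lemma 2 p. 789] -/
theorem dCurv_le_ordH (p : ℕ) [Fact p.Prime] [CharP K p] {e : ℕ} (x y : σ) (hxy : x ≠ y)
    (hσ : ∀ l, l = x ∨ l = y) (h : PowerSeries K) {n : ℕ} (hord : h.order = n) {F : MvPolynomial σ K}
    (hF : F ≠ 0) (hclean : deletePthPowers (p ^ e) F = F) :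
    wOrder (FlagDatum.weights ⟨y, x, h⟩ n) (FlagDatum.expansion ⟨y, x, h⟩ (p ^ e) F) = minPkgWeight x n F ∧
      dCurv (p ^ e) ⟨y, x, h⟩ n F ≤
        (((flatInitial x y n F).natDegree - (flatInitial x y n F).natTrailingDegree +
          (if p ^ e ∣ minPkgWeight x n F then p ^ (e - 1) else 0) : ℕ) : ℕ∞) := by
  have hP0 : flatInitial x y n F ≠ 0 := flatInitial_ne_zero hxy hσ n hF
  have ht : -(PowerSeries.coeff n h) ≠ 0 := neg_ne_zero.mpr (PowerSeries.order_eq_nat.mp hord).1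
  have hcleanP : ∀ b, (flatInitial x y n F).coeff b ≠ 0 → ¬ (p ^ e ∣ b ∧ p ^ e ∣ minPkgWeight x n F) :=
    fun b hb => not_dvd_of_coeff_flatInitial_ne_zero hxy hσ (p ^ e) hclean hb
  have hβ : ∀ b, (flatInitial x y n F).coeff b ≠ 0 → (flatInitial x y n F).natTrailingDegree ≤ b :=
    fun b hb => Polynomial.natTrailingDegree_le_of_ne_zero hb
  obtain ⟨k, hk, hkq, hkle, hkle'⟩ := exists_coeff_taylor_clean p hP0 ht hcleanP hβ le_rfl
  obtain ⟨hwo, hcurv⟩ := dCurv_le_of_coeff_taylor_ne_zero x y hxy hσ h hord (p ^ e) hk hkq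
  refine ⟨hwo, hcurv.trans ?_⟩
  split_ifs with hqw
  · exact_mod_cast hkle
  · rw [add_zero]; exact_mod_cast hkle' hqw

/-- **[HP24, Lemma 2], second assertion:** "In particular, if `ord H = 0`, then `d_𝓕 = 0`" — if the weighted initial
form is a monomial up to a constant (`deg P♭ = tdeg P♭`), then `d_𝓕 = 0`: either `pᵉ ∤ ord_ω(F)` and `d^curv_𝓕 = 0`,
or `d^curv_𝓕 ≤ p^{e−1} < pᵉ` with `pᵉ ∣ ord_ω(F)`, which is the clause `d_𝓕 = 0` of the definition.
[cite: HauserPerlega2024, Lemma 2 p. 789] -/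
theorem dFlag_eq_zero_of_natDegree_eq (p : ℕ) [hp : Fact p.Prime] [CharP K p] {e : ℕ} (x y : σ) (hxy : x ≠ y)
    (hσ : ∀ l, l = x ∨ l = y) (h : PowerSeries K) {n : ℕ} (hord : h.order = n) {F : MvPolynomial σ K}
    (hF : F ≠ 0) (hclean : deletePthPowers (p ^ e) F = F)
    (hmon : (flatInitial x y n F).natDegree = (flatInitial x y n F).natTrailingDegree) :
    dFlag (p ^ e) ⟨y, x, h⟩ n F = 0 := by
  have he : 1 ≤ e := by
    by_contra h0
    have he0 : e = 0 := by omega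
    subst he0
    obtain ⟨d, hd⟩ := MvPolynomial.ne_zero_iff.mp hF
    exact not_isPthPowerExponent_of_clean (p ^ 0) hclean (MvPolynomial.mem_support_iff.mpr hd)
      (fun i _ => by rw [pow_zero]; exact one_dvd _)
  obtain ⟨hwo, hcurv⟩ := dCurv_le_ordH p x y hxy hσ h hord hF hclean (e := e)
  rw [hmon, Nat.sub_self, zero_add] at hcurv
  have hdc := ENat.toNat_le_of_le_coe hcurv
  unfold dFlag
  dsimp only
  rw [hwo, ENat.toNat_coe]
  split_ifs with hc
  · rfl
  · by_cases hqw : p ^ e ∣ minPkgWeight x n F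
    · rw [if_pos hqw] at hdc
      have hlt : p ^ (e - 1) < p ^ e := Nat.pow_lt_pow_right hp.out.one_lt (by omega)
      by_contra hne
      exact hc ⟨Nat.pos_of_ne_zero hne, by omega, hqw⟩
    · rw [if_neg hqw] at hdc
      omega

/-- **[HP24, Lemma 2] for arbitrary flags: the observatory's `TangentFlagBoundStatement` holds.** For `K`
algebraically closed of characteristic `p`, `F ≠ 0` clean w.r.t. `q = pᵉ`, and a flag datum of the tangent case (ii)
(`ord h = n ≥ 1`): `d_𝓕 ≤ d_res + p^{e−1}` — indeed `d_𝓕 ≤ d^curv_𝓕 ≤ k ≤ (D − β) + p^{e−1} ≤ d_res + p^{e−1}` where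
`k` is the exponent produced by the Hasse-derivative argument of Lemma 2 applied to `P♭(Y + t)`, `t = −h_n`
(`exists_coeff_taylor_clean`), the monomial `x₁^{w₀−nk} y₁^k` surviving the cleaning. This is the inequality the
paper draws from Lemmas 1 and 2 at the start of the proof of Proposition 3 (p. 791: "By Lemmas 1 and 2, the inequality
`d_𝓕 ≤ d_res + p^{e−1}` holds for all flags `𝓕 ∈ F`"), here for the flags of case (ii) given in the presentation of
Lemma 1 (`y₁ = y + h(x)`, the tree's `FlagDatum`; the flags of case (i) have `d_𝓕 = d_res` by definition). Characteristic
`0` (`p = 0`, `q = 0`) is covered by the branch `q ∤ w₀`.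
[cite: HauserPerlega2024, Lemma 2 p. 789–790; Prop. 3 (proof) p. 791 (d_𝓕 ≤ d_res + p^{e−1} for all flags)] -/
theorem tangentFlagBoundStatement_holds (p e : ℕ) (K : Type*) [Field K] [CharP K p] [IsAlgClosed K] :
    TangentFlagBoundStatement p e K := by
  classical
  intro E F Φ n hF hclean _ hcase
  obtain ⟨y, x, h⟩ := Φ
  obtain ⟨⟨hne, -⟩, -, hord, hn2⟩ := hcase
  dsimp only at hne hord hn2
  have hn : 1 ≤ n := by rcases hn2 with h2 | ⟨h1, -⟩ <;> omega
  have hxy : x ≠ y := fun hh => hne hh.symm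
  have hσ : ∀ l : Fin 2, l = x ∨ l = y := by
    intro l
    fin_cases l <;> fin_cases x <;> fin_cases y <;> simp_all
  have hFtop : ordZero F ≠ ⊤ := by
    unfold ordZero
    rw [Ne, MvPowerSeries.order_eq_top_iff, MvPolynomial.coe_eq_zero_iff]
    exact hF
  obtain ⟨o, ho'⟩ := WithTop.ne_top_iff_exists.mp hFtop
  have ho : ordZero F = o := ho'.symm
  have hP0 : flatInitial x y n F ≠ 0 := flatInitial_ne_zero hxy hσ n hF
  have ht : -(PowerSeries.coeff n h) ≠ 0 := neg_ne_zero.mpr (PowerSeries.order_eq_nat.mp hord).1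
  obtain ⟨hD, hβ, hres⟩ := natDegree_flatInitial_le_of_ordZero hxy hσ hn ho (K := K)
  have hcleanP : ∀ b, (flatInitial x y n F).coeff b ≠ 0 → ¬ (p ^ e ∣ b ∧ p ^ e ∣ minPkgWeight x n F) :=
    fun b hb => not_dvd_of_coeff_flatInitial_ne_zero hxy hσ (p ^ e) hclean hb
  have key : ∀ k, (Polynomial.taylor (-(PowerSeries.coeff n h)) (flatInitial x y n F)).coeff k ≠ 0 →
      ¬ (p ^ e ∣ k ∧ p ^ e ∣ minPkgWeight x n F) → dFlag (p ^ e) ⟨y, x, h⟩ n F ≤ k :=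
    fun k hk hkq => (dFlag_le_toNat_dCurv _ _ _ _).trans
      (ENat.toNat_le_of_le_coe (dCurv_le_of_coeff_taylor_ne_zero x y hxy hσ h hord (p ^ e) hk hkq).2)
  have hresE := hres E
  by_cases hqw : p ^ e ∣ minPkgWeight x n F
  · rcases CharP.char_is_prime_or_zero K p with hprime | hzero
    · haveI := Fact.mk hprime
      obtain ⟨k, hk, hkq, hkle, -⟩ := exists_coeff_taylor_clean p hP0 ht hcleanP hβ hD
      exact (key k hk hkq).trans (by omega)
    · -- characteristic `0`: `q = 0^e`; `e = 0` contradicts cleanness, `e ≥ 1` gives `q = 0 ∣ w₀`, `w₀ = 0`,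
      -- and the least-weight monomial would be `1`, a `q`-th power
      exfalso
      subst hzero
      rcases Nat.eq_zero_or_pos e with he | he
      · subst he
        obtain ⟨d, hd⟩ := MvPolynomial.ne_zero_iff.mp hF
        exact not_isPthPowerExponent_of_clean (0 ^ 0) hclean (MvPolynomial.mem_support_iff.mpr hd)
          (fun i _ => by rw [pow_zero]; exact one_dvd _)
      · rw [zero_pow he.ne'] at hqw
        have hw0 := Nat.eq_zero_of_zero_dvd hqw
        obtain ⟨d, hd, hdw⟩ := exists_pkgWeight_eq_minPkgWeight x n hF
        rw [pkgWeight_eq_two hxy.symm hσ, hw0] at hdw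
        apply not_isPthPowerExponent_of_clean (0 ^ e) hclean hd
        rw [isPthPowerExponent_iff]
        intro i
        rcases hσ i with rfl | rfl
        · rw [show d i = 0 by omega]; exact dvd_zero _
        · have : n * d i = 0 := by omega
          rw [show d i = 0 from (Nat.mul_eq_zero.mp this).resolve_left (by omega)]; exact dvd_zero _
  · obtain ⟨k, hk, hkle⟩ := exists_coeff_taylor_ne_zero ht hP0 hβ hD
    exact (key k hk (fun hh => hqw hh.2)).trans (by omega)

end Flag

/-! ## E. The third assertion of Lemma 2: `ord H < pᵉ ⇒ d^curv_𝓕 < pᵉ` -/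

section Third

variable {K : Type*} [Field K] (p : ℕ) [hp : Fact p.Prime] [CharP K p]

open Polynomial in
/-- Univariate core of the third assertion. `q = pᵉ`; `P ≠ 0` with NO exponent divisible by `q` and
`deg P − tdeg P < q`; `t ≠ 0`. Then `P(Y + t)` has a non-zero coefficient in some degree `k < q` with `q ∤ k`.
Indeed, if all of them vanished then `P(Y + t) = a₀ + Y^q·S`, so `P = a₀ + (Y^q − t^q)·S̃` in characteristic `p`
(`S̃ = S(Y − t)`, `deg S̃ = deg P − q < tdeg P`); comparing coefficients upward from degree `0` shows that below
`tdeg P` the coefficients of `S̃` live in degrees divisible by `q`, and then the trailing coefficient of `P` sits in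
a degree divisible by `q` — excluded.  (The printed proof treats the case `ord H = pᵉ − p^{e−1}` by comparing two
expressions for `∂_y F′`, `F′` the `p^{e−1}`-th root of `in_ω(F)`; the present count is shorter and gives the
statement for every `ord H < pᵉ`.) [cite: HauserPerlega2024, Lemma 2 p. 789–790 (special case ord H = pᵉ − p^{e−1})] -/
theorem exists_coeff_taylor_lt {e : ℕ} {P : K[X]} (hP : P ≠ 0) {t : K} (ht : t ≠ 0)
    (hq : ∀ b, P.coeff b ≠ 0 → ¬ p ^ e ∣ b) (hdeg : P.natDegree - P.natTrailingDegree < p ^ e) :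
    ∃ k, k < p ^ e ∧ ¬ p ^ e ∣ k ∧ (Polynomial.taylor t P).coeff k ≠ 0 := by
  by_contra hcon
  push Not at hcon
  have hqpos : 0 < p ^ e := pow_pos hp.out.pos e
  have hβ0 : P.coeff P.natTrailingDegree ≠ 0 := Polynomial.coeff_natTrailingDegree_ne_zero.mpr hP
  have hqβ : ¬ p ^ e ∣ P.natTrailingDegree := hq _ hβ0
  have hβpos : P.natTrailingDegree ≠ 0 := fun h0 => hqβ (by rw [h0]; exact dvd_zero _)
  set T : K[X] := Polynomial.taylor t P with hT
  -- `P(Y + t) = a₀ + Y^q S`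
  have hX : (X : K[X]) ^ (p ^ e) ∣ T - C (T.coeff 0) := by
    rw [Polynomial.X_pow_dvd_iff]
    intro d hd
    rw [Polynomial.coeff_sub, Polynomial.coeff_C]
    by_cases hd0 : d = 0
    · subst hd0; simp
    · rw [if_neg hd0, sub_zero]
      exact hcon d hd (fun hdvd => hd0 (Nat.eq_zero_of_dvd_of_lt hdvd hd))
  obtain ⟨S, hS⟩ := hX
  have hPT : P = Polynomial.taylor (-t) T := by
    rw [hT, Polynomial.taylor_taylor, neg_add_cancel, Polynomial.taylor_zero]
  by_cases hS0 : S = 0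
  · rw [hS0, mul_zero, sub_eq_zero] at hS
    apply hβpos
    rw [hPT, hS, Polynomial.taylor_C, Polynomial.natTrailingDegree_C]
  have hTdeg : T.natDegree = P.natDegree := by rw [hT, Polynomial.natDegree_taylor]
  have hdegS : S.natDegree + p ^ e = P.natDegree := by
    have h1 : (T - C (T.coeff 0)).natDegree = T.natDegree := Polynomial.natDegree_sub_C
    have h2 : (T - C (T.coeff 0)).natDegree = p ^ e + S.natDegree := by
      rw [hS, Polynomial.natDegree_mul (pow_ne_zero _ Polynomial.X_ne_zero) hS0, Polynomial.natDegree_X_pow]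
    omega
  have hdegS' : (Polynomial.taylor (-t) S).natDegree < P.natTrailingDegree := by
    rw [Polynomial.natDegree_taylor]; omega
  -- `P = a₀ + (Y^q − t^q) S̃`, `S̃ = S(Y − t)`
  set a₀ : K := T.coeff 0 with ha₀
  have hPeq : P = C a₀ + ((X : K[X]) ^ (p ^ e) - C (t ^ (p ^ e))) * Polynomial.taylor (-t) S := by
    have h2 : T = C a₀ + X ^ (p ^ e) * S := by rw [← hS]; ring
    rw [hPT, h2, map_add, Polynomial.taylor_C, Polynomial.taylor_mul, Polynomial.taylor_pow, Polynomial.taylor_X,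
      Polynomial.C_neg, ← sub_eq_add_neg, sub_pow_char_pow, ← Polynomial.C_pow]
  have hcoeff : ∀ l, P.coeff l = (if l = 0 then a₀ else 0) +
      ((if p ^ e ≤ l then (Polynomial.taylor (-t) S).coeff (l - p ^ e) else 0) -
        t ^ (p ^ e) * (Polynomial.taylor (-t) S).coeff l) := by
    intro l
    conv_lhs => rw [hPeq]
    rw [Polynomial.coeff_add, Polynomial.coeff_C, sub_mul, Polynomial.coeff_sub, Polynomial.coeff_X_pow_mul',
      Polynomial.coeff_C_mul]
  -- below `tdeg P` the coefficients of `S̃` sit in degrees divisible by `q`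
  have hind : ∀ l, l < P.natTrailingDegree → ¬ p ^ e ∣ l → (Polynomial.taylor (-t) S).coeff l = 0 := by
    intro l
    induction l using Nat.strong_induction_on with
    | _ l ih =>
      intro hl hndvd
      have h0 : P.coeff l = 0 := Polynomial.coeff_eq_zero_of_lt_natTrailingDegree hl
      rw [hcoeff l, if_neg (fun h => hndvd (by rw [h]; exact dvd_zero _))] at h0
      have h1 : (if p ^ e ≤ l then (Polynomial.taylor (-t) S).coeff (l - p ^ e) else 0) = 0 := by
        split_ifs with hle
        · refine ih (l - p ^ e) (by omega) (by omega) (fun hdvd => hndvd ?_)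
          have := dvd_add hdvd (dvd_refl (p ^ e))
          rwa [Nat.sub_add_cancel hle] at this
        · rfl
      rw [h1, zero_add, zero_sub, neg_eq_zero, mul_eq_zero] at h0
      exact h0.resolve_left (pow_ne_zero _ ht)
  -- the trailing coefficient of `P` would sit in a degree divisible by `q`
  have hβeq := hcoeff P.natTrailingDegree
  rw [if_neg hβpos, zero_add, Polynomial.coeff_eq_zero_of_natDegree_lt hdegS', mul_zero, sub_zero] at hβeq
  by_cases hle : p ^ e ≤ P.natTrailingDegree
  · rw [if_pos hle] at hβeq
    apply hβ0
    rw [hβeq]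
    refine hind _ (by omega) (fun hdvd => hqβ ?_)
    have := dvd_add hdvd (dvd_refl (p ^ e))
    rwa [Nat.sub_add_cancel hle] at this
  · rw [if_neg hle] at hβeq
    exact hβ0 hβeq

variable {σ : Type*} [Fintype σ] [DecidableEq σ]

/-- **[HP24, Lemma 2], third assertion** ("in the special case `ord H = pᵉ − p^{e−1}`, the inequality
`d^curv_𝓕 < pᵉ` holds"), in the stronger form: `ord H < pᵉ ⇒ d^curv_𝓕 < pᵉ` (two letters, `q = pᵉ`, `F ≠ 0` clean,
flag datum `⟨y, x, h⟩` with `ord h = n`, `ord H = deg P♭ − tdeg P♭`).  If `q ∤ ord_ω(F)` this is the first assertion;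
if `q ∣ ord_ω(F)` every exponent of `P♭` is prime to `q` and `exists_coeff_taylor_lt` gives a surviving monomial
`x₁^{w₀−nk} y₁^k`, `k < q`. [cite: HauserPerlega2024, Lemma 2 p. 789–790] -/
theorem dCurv_lt_of_ordH_lt {e : ℕ} (x y : σ) (hxy : x ≠ y) (hσ : ∀ l, l = x ∨ l = y) (h : PowerSeries K)
    {n : ℕ} (hord : h.order = n) {F : MvPolynomial σ K} (hF : F ≠ 0) (hclean : deletePthPowers (p ^ e) F = F)
    (hH : (flatInitial x y n F).natDegree - (flatInitial x y n F).natTrailingDegree < p ^ e) :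
    dCurv (p ^ e) ⟨y, x, h⟩ n F < ((p ^ e : ℕ) : ℕ∞) := by
  by_cases hqw : p ^ e ∣ minPkgWeight x n F
  · have hP0 := flatInitial_ne_zero hxy hσ n hF
    have ht : -(PowerSeries.coeff n h) ≠ 0 := neg_ne_zero.mpr (PowerSeries.order_eq_nat.mp hord).1
    have hq : ∀ b, (flatInitial x y n F).coeff b ≠ 0 → ¬ p ^ e ∣ b :=
      fun b hb hdvd => not_dvd_of_coeff_flatInitial_ne_zero hxy hσ (p ^ e) hclean hb ⟨hdvd, hqw⟩
    obtain ⟨k, hk, hkq, hkc⟩ := exists_coeff_taylor_lt p hP0 ht hq hH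
    have hle := (dCurv_le_of_coeff_taylor_ne_zero x y hxy hσ h hord (p ^ e) hkc (fun hh => hkq hh.1)).2
    exact lt_of_le_of_lt hle (by exact_mod_cast hk)
  · have hle := (dCurv_le_ordH p x y hxy hσ h hord hF hclean (e := e)).2
    rw [if_neg hqw, add_zero] at hle
    exact lt_of_le_of_lt hle (by exact_mod_cast hH)

/-- The printed special case: `ord H = pᵉ − p^{e−1}` (with `e ≥ 1`) gives `d^curv_𝓕 < pᵉ`.
[cite: HauserPerlega2024, Lemma 2 p. 789] -/
theorem dCurv_lt_of_ordH_eq {e : ℕ} (he : 1 ≤ e) (x y : σ) (hxy : x ≠ y) (hσ : ∀ l, l = x ∨ l = y)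
    (h : PowerSeries K) {n : ℕ} (hord : h.order = n) {F : MvPolynomial σ K} (hF : F ≠ 0)
    (hclean : deletePthPowers (p ^ e) F = F)
    (hH : (flatInitial x y n F).natDegree - (flatInitial x y n F).natTrailingDegree = p ^ e - p ^ (e - 1)) :
    dCurv (p ^ e) ⟨y, x, h⟩ n F < ((p ^ e : ℕ) : ℕ∞) := by
  refine dCurv_lt_of_ordH_lt p x y hxy hσ h hord hF hclean ?_
  rw [hH]
  have : 0 < p ^ (e - 1) := pow_pos hp.out.pos _
  have : p ^ (e - 1) ≤ p ^ e := Nat.pow_le_pow_right hp.out.pos (by omega)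
  omega

end Third

end HauserPerlega2024

end Literature.AlgebraicGeometry.Resolution

end
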